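import Summits.HodgeConjecture.HodgeConjecture.Theorems.GenericDivisibilityGenericDivisibilityBoundedHeartDescent
import Literature.AlgebraicGeometry.Resolution.MarkedIdeals
import HarnessLib

/-!
# The SNC normal form of the heart of line `finite-level-bootstrap`
# (crux C2 `GenericDivisibilityBounded`, stmt-HodgeConjecture-18467)

Registered sub-goal `stub_levelCleanOfSNCWitnesses` (lead c5, wave 3). Sorry-free, definition-free.
As in the sibling files (`…HeartDescent`, `…HeartBirationalUp`), spelled inline: `X`, `X'` smooth
projective over `ℂ`, `z| = z|_{(X∖Z)(ℂ)}` the restriction `H^k(X(ℂ);ℤ) → H^k((X∖Z)(ℂ);ℤ)`;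
"`x ∈ GT(X)`" (generically torsion): `∃ Z` closed `≠ univ`, `∃ N ≥ 1`, `N • x| = 0`;
"`D'_Z(m, z)`" (the level hypothesis WITH ITS WITNESS SET `Z`): `∃ y`, `∃ M ≥ 1`,
`M • (z|_{(X∖Z)(ℂ)} - m • y) = 0`; "`D'(m, z)`": `∃ Z` closed `≠ univ`, `D'_Z(m, z)`; "level `ℓ^s` is
CLEAN at `X`": `∀ z, D'(ℓ^s, z) → ∃ w, z - ℓ • w ∈ GT(X)`.

## The argument

Granted LOG RESOLUTION of proper closed subsets of smooth projective complex varieties (Kollár 2007,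
Thm. 3.26 with `E = ∅` applied to the ideal of `Z`; Hironaka 1964, Main Theorem II) — for `Z ⊊ X`
closed there is `σ : X' → X` birational, `X'` smooth projective of the same dimension, and a
simple-normal-crossing boundary `E` on `X'` with `σ⁻¹(Z) = ⋃ supp E` — spelled as an explicit
hypothesis over the tree's `Resolution.IsBirational` / `Resolution.HasSNC`, a level `ℓ^s` which is
clean FOR SNC WITNESS SETS on every smooth projective birational model of `X` is clean at `X`:
* `D'_Z(m, z) ⇒ D'_{σ⁻¹Z}(m, σ^* z)` (`genericDivisibilityBounded_levelDivisibleOn_map`: apply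
  `(σ|)^*`, restriction commutes with pull-back, `genericDivisibilityBounded_restrict_map`);
* `σ⁻¹Z = ⋃ supp E` is an SNC witness set, `≠ X'` since `σ` is onto (proper birational), so the
  hypothesis gives `w'` with `σ^* z - ℓ • w' ∈ GT(X')`;
* push forward by the INTEGRAL Gysin map `σ_!` of the complex orientations, of degree one
  (`hasDegree_one_complexOrientationInt_of_isBirational`, Fulton Lemma 19.1.2):
  `z - ℓ • σ_! w' = σ_!(σ^* z - ℓ • w') ∈ GT(X)` (`σ_! σ^* = id`, `gysinMap_map_of_hasDegree`,
  Fulton Young Tableaux App. B (6)–(7); `σ_!(GT(X')) ⊆ GT(X)`,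
  `genericDivisibilityBounded_gysinMap_genericallyTorsion`).

## Main results

* `genericDivisibilityBounded_levelDivisibleOn_map` — `D'_Z(m, z) ⇒ D'_{f⁻¹Z}(m, f^* z)`, the
  witness set kept explicit;
* `genericDivisibilityBounded_levelClean_of_isBirational_witness` — for `σ : X' ⟶ X` birational
  between smooth projective `n`-folds, `k + q = 2n`, `k ≥ 1`: if `D'_Z(m, z)` and the clean-level
  conclusion holds at `X'` for `σ^* z` and the ONE witness set `σ⁻¹Z`, then `z - ℓ • w ∈ GT(X)` for
  some `w`;
* `stub_levelCleanOfSNCWitnesses` — the registered signature, verbatim (`n = k = q = 2p`).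

References: [Kollar2007] Thm. 3.26; [Hironaka1964] Main Theorem II; [FultonYoungTableaux1997]
App. B §B.1 (5)–(7); [Fulton1998] Lemma 19.1.2; [HatcherAT2002] §3.1, §3.3 Thm. 3.30.
-/

set_option linter.dupNamespace false

noncomputable section

namespace Summit.HodgeConjecture.HodgeConjecture.Theorems

open CategoryTheory AlgebraicGeometry
open Literature.AlgebraicGeometry.Motives Literature.AlgebraicGeometry.HodgeTheory
  Literature.AlgebraicTopology.SingularHomology

/-- Restriction `H^k(X(ℂ);ℤ) → H^k((X∖Z)(ℂ);ℤ)`, the very term of the route decls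
(notation only). -/
local notation3 (prettyPrint := false) "Res[" X ", " Z ", " k "]" =>
  singularCohomology.map ℤ ℤ
    (⟨Subtype.val, continuous_subtype_val⟩ : C(complexPointsCompl X Z, ComplexPoints X)) k

/-! ### The level hypothesis with its witness set pulls back -/

/-- **`D'_Z(m, z) ⇒ D'_{f⁻¹Z}(m, f^* z)`, the witness set kept explicit.** If
`M • (z|_{(X∖Z)(ℂ)} - m • y) = 0` then `M • ((f^* z)|_{(X'∖f⁻¹Z)(ℂ)} - m • (f|)^* y) = 0`, where
`f| = complexPointsComplMap f Z : (X'∖f⁻¹Z)(ℂ) → (X∖Z)(ℂ)`: apply `(f|)^*` and use that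
restriction commutes with pull-back (`genericDivisibilityBounded_restrict_map`, Hatcher §3.1).
[cite: HatcherAT2002, §3.1] -/
theorem genericDivisibilityBounded_levelDivisibleOn_map {X' X : SchemeOver ℂ} (f : X' ⟶ X) {k : ℕ}
    (m : ℕ) {z : singularCohomology ℤ ℤ (ComplexPoints X) k} {Z : Set X.left}
    (hz : ∃ (y : singularCohomology ℤ ℤ (complexPointsCompl X Z) k) (M : ℕ), 1 ≤ M ∧
      M • (Res[X, Z, k] z - m • y) = 0) :
    ∃ (y' : singularCohomology ℤ ℤ (complexPointsCompl X' (f.left.base ⁻¹' Z)) k) (M : ℕ), 1 ≤ M ∧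
      M • (Res[X', f.left.base ⁻¹' Z, k]
        (singularCohomology.map ℤ ℤ (AlgPoints.mapContinuous (L := ℂ) f) k z) - m • y') = 0 := by
  obtain ⟨y, M, hM, hMz⟩ := hz
  refine ⟨singularCohomology.map ℤ ℤ (complexPointsComplMap f Z) k y, M, hM, ?_⟩
  have h := congrArg (singularCohomology.map ℤ ℤ (complexPointsComplMap f Z) k) hMz
  rw [map_zero, map_nsmul, map_sub, map_nsmul, ← genericDivisibilityBounded_restrict_map] at h
  exact h

/-! ### The heart descends from a birational model where it is known for ONE witness set -/

/-- **The clean-level conclusion descends along a birational `σ : X' ⟶ X` from the single witness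
set `σ⁻¹Z`.** Let `X'`, `X` be smooth projective of dimension `n`, `σ.left` birational,
`k + q = 2n`, `k ≥ 1`, `z ∈ H^k(X(ℂ);ℤ)` with `D'_Z(m, z)`, and `S = σ⁻¹Z`. If
`D'_S(m, σ^* z) ⇒ ∃ w', σ^* z - ℓ • w' ∈ GT(X')`, then `∃ w, z - ℓ • w ∈ GT(X)`:
`D'_S(m, σ^* z)` holds (`genericDivisibilityBounded_levelDivisibleOn_map`); push `σ^* z - ℓ • w'`
forward by the integral Gysin map `σ_!` of the complex orientations, of degree one (Fulton
Lemma 19.1.2, `hasDegree_one_complexOrientationInt_of_isBirational`): `σ_!(GT(X')) ⊆ GT(X)`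
(`genericDivisibilityBounded_gysinMap_genericallyTorsion`) and `σ_! σ^* z = z`
(`gysinMap_map_of_hasDegree`, Poincaré duality `poincare_duality`), so `w = σ_! w'`.
[cite: FultonYoungTableaux1997, Appendix B §B.1 (5)–(7)] [cite: Fulton1998, Lemma 19.1.2] -/
theorem genericDivisibilityBounded_levelClean_of_isBirational_witness {n : ℕ} {X' X : SchemeOver ℂ}
    (σ : X' ⟶ X) (hX' : IsSmoothProjective n X') (hX : IsSmoothProjective n X)
    (hσ : Literature.AlgebraicGeometry.Resolution.IsBirational σ.left) {k q : ℕ}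
    (hkq : k + q = 2 * n) (hk : 1 ≤ k) (ℓ m : ℕ) (z : singularCohomology ℤ ℤ (ComplexPoints X) k)
    {Z : Set X.left} {S : Set X'.left} (hS : σ.left.base ⁻¹' Z = S)
    (hC : (∃ (y' : singularCohomology ℤ ℤ (complexPointsCompl X' S) k) (M : ℕ), 1 ≤ M ∧
        M • (Res[X', S, k] (singularCohomology.map ℤ ℤ (AlgPoints.mapContinuous (L := ℂ) σ) k z) -
          m • y') = 0) →
      ∃ w' : singularCohomology ℤ ℤ (ComplexPoints X') k, ∃ Z' : Set X'.left, IsClosed Z' ∧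
        Z' ≠ Set.univ ∧ ∃ N : ℕ, 1 ≤ N ∧
          N • Res[X', Z', k]
            (singularCohomology.map ℤ ℤ (AlgPoints.mapContinuous (L := ℂ) σ) k z - ℓ • w') = 0)
    (hz : ∃ (y : singularCohomology ℤ ℤ (complexPointsCompl X Z) k) (M : ℕ), 1 ≤ M ∧
      M • (Res[X, Z, k] z - m • y) = 0) :
    ∃ w : singularCohomology ℤ ℤ (ComplexPoints X) k, ∃ Z₁ : Set X.left, IsClosed Z₁ ∧
      Z₁ ≠ Set.univ ∧ ∃ N : ℕ, 1 ≤ N ∧ N • Res[X, Z₁, k] (z - ℓ • w) = 0 := by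
  subst hS
  -- Poincaré duality for the complex `ℤ`-orientation of `X(ℂ)` (Hatcher Thm. 3.30, in the tree)
  have hν : (complexOrientationInt hX).HasPoincareDuality := fun _ _ h' ↦
    ComplexPoints.bijective_poincareDualityMap_of (fun ν' _ _ h'' ↦ poincare_duality ν' h'') hX _ h'
  have hdeg := hasDegree_one_complexOrientationInt_of_isBirational hX' hX σ hσ
  -- the clean level at `X'` for `σ^* z`, off `σ⁻¹Z`
  obtain ⟨w', hw'⟩ := hC (genericDivisibilityBounded_levelDivisibleOn_map σ m hz)
  -- push forward: `z - ℓ • σ_! w' ∈ GT(X)`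
  have hGT := genericDivisibilityBounded_gysinMap_genericallyTorsion hX' hX σ
    (complexOrientationInt hX') (complexOrientationInt hX) hkq hkq le_rfl hk hk hw'
  rw [map_sub, map_nsmul, gysinMap_map_of_hasDegree hν hdeg hkq z, one_smul] at hGT
  exact ⟨_, hGT⟩

/-! ### The registered sub-goal -/

/-- **Registered sub-goal `stub_levelCleanOfSNCWitnesses` of stmt-HodgeConjecture-18467 (lead c5,
wave 3, line `finite-level-bootstrap`): the SNC normal form of the heart.** Granted log resolution
of proper closed subsets of smooth projective complex varieties (first hypothesis; Kollár 2007
Thm. 3.26 "Principalization III" with `E = ∅` applied to the ideal of `Z` — a composite of smooth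
blow-ups `σ : X' → X` with `σ⁻¹(Z)` a simple-normal-crossing divisor; Hironaka 1964 Main
Theorem II), level `ℓ^s` is clean at the smooth projective `2p`-fold `X` (`p ≥ 1`) as soon as it
is clean FOR SNC WITNESS SETS `⋃ supp E ≠ X'` on every smooth projective birational model
`σ : X' ⟶ X` (second hypothesis): given `D'_Z(ℓ^s, z)` with `Z` closed `≠ X`, resolve `Z`
(`σ⁻¹Z = ⋃ supp E`, SNC, and `≠ X'` since `σ` is onto: proper, `isProper_left_of_isSmoothProjective`,
and birational, `surjective_base_of_isBirational`), and descend from the witness set `σ⁻¹Z`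
(`genericDivisibilityBounded_levelClean_of_isBirational_witness`: pull back, apply the hypothesis,
push forward by the integral Gysin map of degree one). Statement: the skeleton's, verbatim.
[cite: Kollar2007, Thm. 3.26] [cite: Hironaka1964, Main Theorem II]
[cite: FultonYoungTableaux1997, Appendix B §B.1 (5)–(7)] -/
theorem stub_levelCleanOfSNCWitnesses :
    (∀ (n : ℕ) (X : SchemeOver ℂ), IsSmoothProjective n X → ∀ Z : Set X.left, IsClosed Z → Z ≠ Set.univ →
      ∃ (X' : SchemeOver ℂ) (σ : X' ⟶ X) (E : List X'.left.IdealSheafData),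
        IsSmoothProjective n X' ∧ Literature.AlgebraicGeometry.Resolution.IsBirational σ.left ∧
        Literature.AlgebraicGeometry.Resolution.HasSNC E ∧
        σ.left.base ⁻¹' Z = ⋃ D ∈ E, ((D.support : Set X'.left))) →
    ∀ ⦃p : ℕ⦄ ⦃X : SchemeOver ℂ⦄, 1 ≤ p → IsSmoothProjective (2 * p) X → ∀ ℓ s : ℕ,
      (∀ (X' : SchemeOver ℂ) (σ : X' ⟶ X) (E : List X'.left.IdealSheafData),
        IsSmoothProjective (2 * p) X' → Literature.AlgebraicGeometry.Resolution.IsBirational σ.left →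
        Literature.AlgebraicGeometry.Resolution.HasSNC E →
        (⋃ D ∈ E, ((D.support : Set X'.left))) ≠ Set.univ →
        ∀ z' : singularCohomology ℤ ℤ (ComplexPoints X') (2 * p),
          (∃ (y : singularCohomology ℤ ℤ (complexPointsCompl X' (⋃ D ∈ E, ((D.support : Set X'.left)))) (2 * p))
              (M : ℕ), 1 ≤ M ∧
            M • (singularCohomology.map ℤ ℤ
              (⟨Subtype.val, continuous_subtype_val⟩ :
                C(complexPointsCompl X' (⋃ D ∈ E, ((D.support : Set X'.left))), ComplexPoints X'))
              (2 * p) z' - ℓ ^ s • y) = 0) →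
          ∃ w : singularCohomology ℤ ℤ (ComplexPoints X') (2 * p),
            ∃ Z' : Set X'.left, IsClosed Z' ∧ Z' ≠ Set.univ ∧ ∃ N : ℕ, 1 ≤ N ∧
              N • singularCohomology.map ℤ ℤ
                (⟨Subtype.val, continuous_subtype_val⟩ : C(complexPointsCompl X' Z', ComplexPoints X'))
                (2 * p) (z' - ℓ • w) = 0) →
      ∀ z : singularCohomology ℤ ℤ (ComplexPoints X) (2 * p),
        (∃ Z : Set X.left, IsClosed Z ∧ Z ≠ Set.univ ∧
          ∃ (y : singularCohomology ℤ ℤ (complexPointsCompl X Z) (2 * p)) (M : ℕ), 1 ≤ M ∧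
            M • (singularCohomology.map ℤ ℤ
              (⟨Subtype.val, continuous_subtype_val⟩ : C(complexPointsCompl X Z, ComplexPoints X))
              (2 * p) z - ℓ ^ s • y) = 0) →
        ∃ w : singularCohomology ℤ ℤ (ComplexPoints X) (2 * p),
          ∃ Z : Set X.left, IsClosed Z ∧ Z ≠ Set.univ ∧ ∃ N : ℕ, 1 ≤ N ∧
            N • singularCohomology.map ℤ ℤ
              (⟨Subtype.val, continuous_subtype_val⟩ : C(complexPointsCompl X Z, ComplexPoints X))
              (2 * p) (z - ℓ • w) = 0 := by
  intro hres p X hp hX ℓ s hSNC z hz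
  obtain ⟨Z, hZ, hZne, y, M, hM, hMz⟩ := hz
  obtain ⟨X', σ, E, hX', hσ, hE, heq⟩ := hres (2 * p) X hX Z hZ hZne
  haveI : IsProper σ.left := isProper_left_of_isSmoothProjective hX' hX σ
  have hsurj : Function.Surjective σ.left.base := surjective_base_of_isBirational σ.left hσ
  have hne : (⋃ D ∈ E, ((D.support : Set X'.left))) ≠ Set.univ :=
    heq ▸ genericDivisibilityBounded_preimage_ne_univ σ hsurj hZne
  exact genericDivisibilityBounded_levelClean_of_isBirational_witness σ hX' hX hσ (q := 2 * p)
    (by omega) (by omega) ℓ (ℓ ^ s) z heq (hSNC X' σ E hX' hσ hE hne _) ⟨y, M, hM, hMz⟩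

end Summit.HodgeConjecture.HodgeConjecture.Theorems

end
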